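import Mathlib
import HarnessLib
import Summits.HubbardSuperconductivity.HubbardSuperconductivity.Theorems.KLProgrammeKLRegimeVolumeLimitDefs

/-!
# Route `KLProgramme` — crux K3 `KLRegimeTwoPointLimit` (stmt-HubbardSuperconductivity-19937), child «VolumeLimit»
# (gen 3: stmt-…-19826 `KLRegimeVolumeLimitV11 := VolumeLimitP2 klPredsV11 FinalTwoLegVolLimit klWindowC`):
# the CAUCHY ROUTE into the slot text `FinalTwoLegVolLimit β U μ K Mstar` — a TWO-VOLUME RATE with cross-grid modulus
# implies the three clauses (cell gate-hubbard-kl, seat hubbard-kl-k3c4-p1 g3, technique «volume lemmas»)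

WHY.  The volume-limit text (`KLProgrammeKLRegimeVolumeLimitDefs.FinalTwoLegVolLimit`) asks, for the two-leg vertex function
`Σ̂_{L,M} = klSelfEnergy L M β U μ K klE0 (nScales β + 1)` of the fully integrated countertermed action, (i) a bound uniform in the
volume beyond thresholds, and (ii) per Matsubara integer, convergence on the torus momentum grid, uniformly on the grid, eventually in
`L` and then in `M`, to a momentum-CONTINUOUS limit `Σ∞`.  The per-volume slots of the bundle (`TowerP klPredsV11`) are
(in)equalities at ONE volume and supply neither clause (Δ-asm (A)); `…VolumeLimitTannery.finalTwoLegVolLimit_of_termwise` reaches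
the text from TERMWISE data (a named family of tree values, majorants, termwise limits), which no slot can carry.  This module is the
second door, whose hypothesis IS slot-shaped — an inequality between the carrier at TWO volumes, the grammar of the existing (E3f)
`TwoLegVolumeRate` clause of `…SplitBundleV7` (which reads the local part only):

* `volLimit_of_twoVolumeRate'` / `volLimit_of_twoVolumeRate` — ABSTRACT form, any grid family `S L M : FreqMomentum L M → Fin 2 → ℂ`:
  if beyond thresholds `(L₀, Mth)` (a) `‖S L M k σ‖ ≤ B`, and (b) for `L₀ ≤ L ≤ L′`, `Mth L ≤ M`, `Mth L′ ≤ M′`, equal Matsubara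
  integers and ALL torus momenta `k, k′`: `‖S L M (ω,k) σ − S L′ M′ (ω′,k′) σ‖ ≤ ρ L + D · Σ_i |p_k i − p′_{k′} i|_𝕋` with `ρ → 0`
  (`|·|_𝕋 = torusAbs`, the distance to `2πℤ`), then the three clauses hold with `Mstar = Mth`: `Σ∞ n p σ` is the limit of `S` along
  the floor grid points of `p` (a Cauchy sequence in `ℂ`: two such values differ by `ρ L + D·8π/L`), it is `max D 0`-Lipschitz in the
  torus modulus `Σ_i |p_i − q_i|_𝕋 ≤ 2‖p − q‖` (hence continuous), and the grid values at `(L, M)` are within `ρ L` of it;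
* `finalTwoLegVolLimit_of_twoVolumeRate` (+ the `∃ M'` form) — the instance `S = klSelfEnergy … (nScales β + 1)`:
  **two-volume rate with cross-grid modulus + uniform bound ⇒ `FinalTwoLegVolLimit β U μ K Mth`.**

So a two-leg slot clause of a later bundle «at `n = nScales β + 1`, `Q.M0 β L ≤ M`, for every larger volume `(L′, M′)` carrying the
history: the displayed bound with `ρ L = Q.CΣ β / L`, `D = Q.DΣ β`» lets the VL child close FROM the tower (as child 2 consumed (E3f),
`…SplitChildTwoVolumeTransfer`), the engine owing the rate termwise (Riemann-sum RATES, `Literature/…/BrillouinRiemannSumRate`, under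
its `L`-uniform majorants).  Everything PROVED; no definition, no named fact; nothing is asserted about the model.  References (bounds
uniform in the volume, then the limit): G. Benfatto, A. Giuliani, V. Mastropietro, Ann. Henri Poincaré 7 (2006) 809–898, §2.3 fn. 1,
§2.4 (2.38); J. Feldman, J. Magnen, V. Rivasseau, E. Trubowitz, Helv. Phys. Acta 65 (1992) 679, Thm 1.
-/


noncomputable section

namespace Summit.HubbardSuperconductivity.HubbardSuperconductivity.Theorems.KLRegimeSplit

set_option linter.dupNamespace false -- summit = problem name (single-conjunct summit), D-0017

open Filter Topology Finset Literature.MathematicalPhysics.QuantumLattice Literature.Probability.LatticeModels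
open Summit.HubbardSuperconductivity.HubbardSuperconductivity.Theorems.KLProgrammeLegKernels

/-! ## §1 `torusAbs` bookkeeping: the torus modulus `Σ_i |p_i − q_i|_𝕋` -/

/-- `0 ≤ |x|_𝕋`. [folklore] -/
theorem klvc_torusAbs_nonneg (x : ℝ) : 0 ≤ torusAbs x := abs_nonneg _

/-- `|x|_𝕋 ≤ |x|`. [folklore] -/
theorem klvc_torusAbs_le_abs (x : ℝ) : torusAbs x ≤ |x| := by
  simpa using torusAbs_le x 0

/-- `|0|_𝕋 = 0`. [folklore] -/
theorem klvc_torusAbs_zero : torusAbs 0 = 0 :=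
  le_antisymm (by simpa using klvc_torusAbs_le_abs 0) (klvc_torusAbs_nonneg 0)

/-- `|x − 2πm|_𝕋 = |x|_𝕋` for every integer `m`. [folklore] -/
theorem klvc_torusAbs_sub_int_mul (x : ℝ) (m : ℤ) : torusAbs (x - m * (2 * Real.pi)) = torusAbs x := by
  unfold torusAbs
  rw [show x - m * (2 * Real.pi) = x - m • (2 * Real.pi) by rw [zsmul_eq_mul], toIocMod_sub_zsmul]

/-- `|−x|_𝕋 = |x|_𝕋`. [folklore] -/
theorem klvc_torusAbs_neg (x : ℝ) : torusAbs (-x) = torusAbs x := by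
  have key : ∀ y : ℝ, torusAbs (-y) ≤ torusAbs y := by
    intro y
    have hy := toIocMod_add_toIocDiv_zsmul Real.two_pi_pos (-Real.pi) y
    rw [zsmul_eq_mul] at hy
    have h := torusAbs_le (-y) (-toIocDiv Real.two_pi_pos (-Real.pi) y)
    have heq : -y - ((-toIocDiv Real.two_pi_pos (-Real.pi) y : ℤ) : ℝ) * (2 * Real.pi) =
        -toIocMod Real.two_pi_pos (-Real.pi) y := by
      push_cast; linarith
    rw [heq, abs_neg] at h
    exact h
  refine le_antisymm (key x) ?_
  simpa using key (-x)

/-- `|x − y|_𝕋 = |y − x|_𝕋`. [folklore] -/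
theorem klvc_torusAbs_sub_comm (x y : ℝ) : torusAbs (x - y) = torusAbs (y - x) := by
  rw [← klvc_torusAbs_neg, neg_sub]

/-- Subadditivity: `|x + y|_𝕋 ≤ |x|_𝕋 + |y|_𝕋`. [folklore] -/
theorem klvc_torusAbs_add_le (x y : ℝ) : torusAbs (x + y) ≤ torusAbs x + torusAbs y := by
  have hx := toIocMod_add_toIocDiv_zsmul Real.two_pi_pos (-Real.pi) x
  have hy := toIocMod_add_toIocDiv_zsmul Real.two_pi_pos (-Real.pi) y
  rw [zsmul_eq_mul] at hx hy
  have h := torusAbs_le (x + y) (toIocDiv Real.two_pi_pos (-Real.pi) x + toIocDiv Real.two_pi_pos (-Real.pi) y)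
  have heq : x + y - ((toIocDiv Real.two_pi_pos (-Real.pi) x + toIocDiv Real.two_pi_pos (-Real.pi) y : ℤ) : ℝ) *
      (2 * Real.pi) = toIocMod Real.two_pi_pos (-Real.pi) x + toIocMod Real.two_pi_pos (-Real.pi) y := by
    push_cast; linarith
  rw [heq] at h
  exact h.trans (abs_add_le _ _)

/-- Triangle inequality for the torus modulus `Σ_i |p_i − q_i|_𝕋` on `Fin 2 → ℝ`. [folklore] -/
theorem klvc_tmod_triangle (p q r : Fin 2 → ℝ) :
    ∑ i, torusAbs (p i - r i) ≤ ∑ i, torusAbs (p i - q i) + ∑ i, torusAbs (q i - r i) := by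
  rw [← Finset.sum_add_distrib]
  refine Finset.sum_le_sum fun i _ => ?_
  have h := klvc_torusAbs_add_le (p i - q i) (q i - r i)
  rwa [show p i - q i + (q i - r i) = p i - r i by ring] at h

/-- The torus modulus vanishes on the diagonal. [folklore] -/
theorem klvc_tmod_self (p : Fin 2 → ℝ) : ∑ i, torusAbs (p i - p i) = 0 := by
  simp [klvc_torusAbs_zero]

/-- `0 ≤ Σ_i |p_i − q_i|_𝕋`. [folklore] -/
theorem klvc_tmod_nonneg (p q : Fin 2 → ℝ) : 0 ≤ ∑ i, torusAbs (p i - q i) :=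
  Finset.sum_nonneg fun _ _ => klvc_torusAbs_nonneg _

/-- The torus modulus is dominated by the sup norm: `Σ_i |p_i − q_i|_𝕋 ≤ 2‖p − q‖`. [folklore] -/
theorem klvc_tmod_le_two_mul_norm (p q : Fin 2 → ℝ) : ∑ i, torusAbs (p i - q i) ≤ 2 * ‖p - q‖ := by
  calc ∑ i, torusAbs (p i - q i) ≤ ∑ _i : Fin 2, ‖p - q‖ := Finset.sum_le_sum fun i _ => by
          refine (klvc_torusAbs_le_abs _).trans ?_
          have h := norm_le_pi_norm (p - q) i
          simpa [Real.norm_eq_abs] using h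
    _ = 2 * ‖p - q‖ := by simp

/-! ## §2 Grid points near a continuum momentum; Matsubara labels of a given integer -/

/-- **Floor grid points**: every continuum momentum `p` has, at every `L ≥ 1`, a torus site whose lattice momentum is within `2π/L`
of `p` in every coordinate, modulo `2π` (take `k_i = ⌊p_i L / 2π⌋ mod L`). [folklore] -/
theorem klvc_exists_site_near (L : ℕ) [NeZero L] (p : Fin 2 → ℝ) :
    ∃ k : TorusSite 2 L, ∀ i, torusAbs (latticeMomentum L k i - p i) ≤ 2 * Real.pi / L := by
  have hL : (0 : ℝ) < L := Nat.cast_pos.mpr (Nat.pos_of_ne_zero (NeZero.ne L))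
  have h2π : (0 : ℝ) < 2 * Real.pi := Real.two_pi_pos
  refine ⟨fun i => ((⌊p i * L / (2 * Real.pi)⌋ : ℤ) : ZMod L), fun i => ?_⟩
  set a : ℤ := ⌊p i * L / (2 * Real.pi)⌋ with ha
  -- the representative of `a mod L`
  have hval : (((a : ZMod L).val : ℕ) : ℤ) = a % (L : ℤ) := ZMod.val_intCast a
  have hvalR : (((a : ZMod L).val : ℕ) : ℝ) = ((a % (L : ℤ) : ℤ) : ℝ) := by
    rw [← hval]; simp
  have hmod : ((a % (L : ℤ) : ℤ) : ℝ) = (a : ℝ) - (L : ℝ) * ((a / (L : ℤ) : ℤ) : ℝ) := by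
    rw [Int.emod_def]; push_cast; ring
  have hlm : latticeMomentum L (fun i => ((⌊p i * L / (2 * Real.pi)⌋ : ℤ) : ZMod L)) i - p i =
      (2 * Real.pi * a / L - p i) - ((a / (L : ℤ) : ℤ) : ℝ) * (2 * Real.pi) := by
    simp only [latticeMomentum]
    rw [← ha, hvalR, hmod]
    field_simp
    ring
  rw [hlm, klvc_torusAbs_sub_int_mul]
  refine (klvc_torusAbs_le_abs _).trans ?_
  -- `a ≤ p_i L/2π < a + 1`
  have h1 : (a : ℝ) ≤ p i * L / (2 * Real.pi) := Int.floor_le _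
  have h2 : p i * L / (2 * Real.pi) < a + 1 := Int.lt_floor_add_one _
  have h1' : 2 * Real.pi * a / L ≤ p i := by
    rw [div_le_iff₀ hL]
    have := mul_le_mul_of_nonneg_left h1 h2π.le
    rw [mul_div_cancel₀ _ h2π.ne'] at this
    linarith
  have h2' : p i < 2 * Real.pi * a / L + 2 * Real.pi / L := by
    rw [← add_div, lt_div_iff₀ hL]
    have := mul_lt_mul_of_pos_left h2 h2π
    rw [mul_div_cancel₀ _ h2π.ne'] at this
    linarith
  rw [abs_le]
  constructor <;> linarith [div_pos h2π hL]

/-- At cutoff `M > |n|` the integer `n` is the Matsubara integer of some label. [folklore] -/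
theorem klvc_exists_matsubaraIdx {M : ℕ} {n : ℤ} (h : n.natAbs < M) :
    ∃ ω : MatsubaraIdx M, matsubaraInt M ω = n := by
  refine ⟨⟨(n + M).toNat, by omega⟩, ?_⟩
  show (((n + (M : ℤ)).toNat : ℕ) : ℤ) - (M : ℤ) = n
  omega

/-! ## §3 The Cauchy route: two-volume rate with cross-grid modulus ⇒ the three clauses -/

/-- **Two-volume rate ⇒ the volume-limit clauses, with the Lipschitz modulus of the limit** (abstract form).  Let
`S L M : FreqMomentum L M → Fin 2 → ℂ` be a volume-indexed grid family with, beyond thresholds `(L₀, Mth)`, (a) a uniform bound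
`‖S L M k σ‖ ≤ B`, and (b) a TWO-VOLUME RATE WITH CROSS-GRID MODULUS: for `L₀ ≤ L ≤ L′`, `Mth L ≤ M`, `Mth L′ ≤ M′`, every spin,
every pair of frequency labels with the same Matsubara integer and every pair of torus momenta,
`‖S L M (ω, k) σ − S L′ M′ (ω′, k′) σ‖ ≤ ρ L + D · Σ_i |p_k i − p′_{k′} i|_𝕋`, where `ρ → 0`.  Then there is
`Σ∞ : ℤ → (Fin 2 → ℝ) → Fin 2 → ℂ`, `max D 0`-Lipschitz in the torus modulus (hence continuous in the momentum), such that `S` is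
bounded by `B` beyond `(L₀, Mth)` and, for every Matsubara integer, converges to `Σ∞` on the grid, uniformly on the grid, eventually
in `L` and then in `M ≥ Mth L` (the grid values at `(L, M)` are within `ρ L` of the limit). [folklore] -/
theorem volLimit_of_twoVolumeRate'
    {S : ∀ (L M : ℕ) [NeZero L] [NeZero M], FreqMomentum L M → Fin 2 → ℂ} {Mth : ℕ → ℕ} {L₀ : ℕ}
    {B D : ℝ} {ρ : ℕ → ℝ} (hρ : Tendsto ρ atTop (𝓝 0))
    (hbdd : ∀ (L : ℕ) [NeZero L], L₀ ≤ L → ∀ (M : ℕ) [NeZero M], Mth L ≤ M →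
      ∀ (k : FreqMomentum L M) (σ : Fin 2), ‖S L M k σ‖ ≤ B)
    (hrate : ∀ (L : ℕ) [NeZero L], L₀ ≤ L → ∀ (M : ℕ) [NeZero M], Mth L ≤ M →
      ∀ (L' : ℕ) [NeZero L'], L ≤ L' → ∀ (M' : ℕ) [NeZero M'], Mth L' ≤ M' →
        ∀ (σ : Fin 2) (ω : MatsubaraIdx M) (ω' : MatsubaraIdx M'), matsubaraInt M ω = matsubaraInt M' ω' →
          ∀ (k : TorusSite 2 L) (k' : TorusSite 2 L'),
            ‖S L M (ω, k) σ - S L' M' (ω', k') σ‖ ≤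
              ρ L + D * ∑ i, torusAbs (latticeMomentum L k i - latticeMomentum L' k' i)) :
    ∃ sigmaInf : ℤ → (Fin 2 → ℝ) → Fin 2 → ℂ,
      (∀ (n : ℤ) (σ : Fin 2) (p q : Fin 2 → ℝ),
        ‖sigmaInf n p σ - sigmaInf n q σ‖ ≤ max D 0 * ∑ i, torusAbs (p i - q i)) ∧
      (∀ (n : ℤ) (σ : Fin 2), Continuous fun p : Fin 2 → ℝ => sigmaInf n p σ) ∧
      (∀ (L : ℕ) [NeZero L], L₀ ≤ L → ∀ (M : ℕ) [NeZero M], Mth L ≤ M →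
        ∀ (k : FreqMomentum L M) (σ : Fin 2), ‖S L M k σ‖ ≤ B) ∧
      (∀ (n : ℤ) (σ : Fin 2) (ε : ℝ), 0 < ε → ∃ L₁ : ℕ, ∀ (L : ℕ) [NeZero L], L₁ ≤ L →
        ∀ (M : ℕ) [NeZero M], Mth L ≤ M → ∀ ω : MatsubaraIdx M, matsubaraInt M ω = n →
          ∀ k : TorusSite 2 L, ‖S L M (ω, k) σ - sigmaInf n (latticeMomentum L k) σ‖ ≤ ε) := by
  classical
  -- WLOG `0 ≤ D`
  set D' : ℝ := max D 0 with hD'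
  have hD'D : D ≤ D' := le_max_left _ _
  have hD'0 : 0 ≤ D' := le_max_right _ _
  -- floor grid points and Matsubara labels
  choose kL hkL using fun (L : ℕ) (hL : NeZero L) (p : Fin 2 → ℝ) => @klvc_exists_site_near L hL p
  choose ωM hωM using fun (M : ℕ) (n : ℤ) (h : n.natAbs < M) => klvc_exists_matsubaraIdx h
  -- the Matsubara cutoff of the defining sequence at `L = j + 1`
  have instMj : ∀ (n : ℤ) (j : ℕ), NeZero (max (Mth (j + 1)) (n.natAbs + 1)) := fun n j =>
    ⟨by have := le_max_right (Mth (j + 1)) (n.natAbs + 1); omega⟩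
  have hMj1 : ∀ (n : ℤ) (j : ℕ), n.natAbs < max (Mth (j + 1)) (n.natAbs + 1) := fun n j => by
    have := le_max_right (Mth (j + 1)) (n.natAbs + 1); omega
  -- the defining sequence: `S` at `L = j+1`, cutoff `Mj`, the label of integer `n`, the floor grid point of `p`
  obtain ⟨a, ha⟩ : ∃ a : ℤ → Fin 2 → (Fin 2 → ℝ) → ℕ → ℂ, ∀ n σ p j, a n σ p j =
      @S (j + 1) (max (Mth (j + 1)) (n.natAbs + 1)) _ (instMj n j)
        (ωM _ n (hMj1 n j), kL (j + 1) inferInstance p) σ := ⟨_, fun _ _ _ _ => rfl⟩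
  -- (E) the basic estimate: a grid value at `(L, M)` against the sequence at `j + 1 ≥ L`
  have hest : ∀ (n : ℤ) (σ : Fin 2) (q : Fin 2 → ℝ) (L : ℕ) [NeZero L], L₀ ≤ L → ∀ (M : ℕ) [NeZero M], Mth L ≤ M →
      ∀ (ω : MatsubaraIdx M), matsubaraInt M ω = n → ∀ (k : TorusSite 2 L) (j : ℕ), L ≤ j + 1 →
        ‖S L M (ω, k) σ - a n σ q j‖ ≤
          ρ L + D' * (∑ i, torusAbs (latticeMomentum L k i - q i) + 4 * Real.pi / ((j + 1 : ℕ) : ℝ)) := by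
    intro n σ q L _ hL M _ hM ω hω k j hj
    rw [ha]
    have h := @hrate L _ hL M _ hM (j + 1) _ hj (max (Mth (j + 1)) (n.natAbs + 1)) (instMj n j) (le_max_left _ _) σ ω
      (ωM _ n (hMj1 n j)) (by rw [hω, hωM]) k (kL (j + 1) inferInstance q)
    refine h.trans ?_
    set r : Fin 2 → ℝ := latticeMomentum (j + 1) (kL (j + 1) inferInstance q) with hr
    have hnear : ∀ i, torusAbs (q i - r i) ≤ 2 * Real.pi / ((j + 1 : ℕ) : ℝ) := fun i => by
      rw [klvc_torusAbs_sub_comm]; exact hkL (j + 1) inferInstance q i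
    have hsum : ∑ i, torusAbs (latticeMomentum L k i - r i) ≤
        ∑ i, torusAbs (latticeMomentum L k i - q i) + 4 * Real.pi / ((j + 1 : ℕ) : ℝ) := by
      calc ∑ i, torusAbs (latticeMomentum L k i - r i)
          ≤ ∑ i, torusAbs (latticeMomentum L k i - q i) + ∑ i, torusAbs (q i - r i) := klvc_tmod_triangle _ q r
        _ ≤ ∑ i, torusAbs (latticeMomentum L k i - q i) + ∑ _i : Fin 2, 2 * Real.pi / ((j + 1 : ℕ) : ℝ) := by
            gcongr with i _
            exact hnear i
        _ = ∑ i, torusAbs (latticeMomentum L k i - q i) + 4 * Real.pi / ((j + 1 : ℕ) : ℝ) := by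
            simp only [Finset.sum_const, Finset.card_univ, Fintype.card_fin, nsmul_eq_mul]
            ring
    have hnn : 0 ≤ ∑ i, torusAbs (latticeMomentum L k i - r i) := klvc_tmod_nonneg _ _
    calc ρ L + D * ∑ i, torusAbs (latticeMomentum L k i - r i)
        ≤ ρ L + D' * ∑ i, torusAbs (latticeMomentum L k i - r i) := by
          gcongr ρ L + ?_
          exact mul_le_mul_of_nonneg_right hD'D hnn
      _ ≤ ρ L + D' * (∑ i, torusAbs (latticeMomentum L k i - q i) + 4 * Real.pi / ((j + 1 : ℕ) : ℝ)) := by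
          gcongr
  -- (E2) two members of the defining sequences
  have hest2 : ∀ (n : ℤ) (σ : Fin 2) (p q : Fin 2 → ℝ) (j j' : ℕ), L₀ ≤ j + 1 → j ≤ j' →
      ‖a n σ p j - a n σ q j'‖ ≤ ρ (j + 1) + D' * (∑ i, torusAbs (p i - q i) +
        4 * Real.pi / ((j + 1 : ℕ) : ℝ) + 4 * Real.pi / ((j' + 1 : ℕ) : ℝ)) := by
    intro n σ p q j j' hj hjj'
    have h := @hest n σ q (j + 1) _ hj (max (Mth (j + 1)) (n.natAbs + 1)) (instMj n j) (le_max_left _ _)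
      (ωM _ n (hMj1 n j)) (hωM _ _ _) (kL (j + 1) inferInstance p) j' (by omega)
    rw [ha n σ p j]
    refine h.trans ?_
    set r : Fin 2 → ℝ := latticeMomentum (j + 1) (kL (j + 1) inferInstance p) with hr
    have hsum : ∑ i, torusAbs (r i - q i) ≤ ∑ i, torusAbs (p i - q i) + 4 * Real.pi / ((j + 1 : ℕ) : ℝ) := by
      calc ∑ i, torusAbs (r i - q i) ≤ ∑ i, torusAbs (r i - p i) + ∑ i, torusAbs (p i - q i) := klvc_tmod_triangle r p q
        _ ≤ ∑ _i : Fin 2, 2 * Real.pi / ((j + 1 : ℕ) : ℝ) + ∑ i, torusAbs (p i - q i) := by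
            gcongr with i _
            exact hkL (j + 1) inferInstance p i
        _ = ∑ i, torusAbs (p i - q i) + 4 * Real.pi / ((j + 1 : ℕ) : ℝ) := by
            simp only [Finset.sum_const, Finset.card_univ, Fintype.card_fin, nsmul_eq_mul]
            ring
    have hm : D' * (∑ i, torusAbs (r i - q i) + 4 * Real.pi / ((j' + 1 : ℕ) : ℝ)) ≤
        D' * (∑ i, torusAbs (p i - q i) + 4 * Real.pi / ((j + 1 : ℕ) : ℝ) + 4 * Real.pi / ((j' + 1 : ℕ) : ℝ)) :=
      mul_le_mul_of_nonneg_left (by linarith [hsum]) hD'0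
    linarith [hm]
  -- the vanishing comparison terms
  have hρ1 : Tendsto (fun j : ℕ => ρ (j + 1)) atTop (𝓝 0) := hρ.comp (tendsto_add_atTop_nat 1)
  have h4π : Tendsto (fun j : ℕ => 4 * Real.pi / ((j + 1 : ℕ) : ℝ)) atTop (𝓝 0) :=
    (tendsto_const_div_atTop_nhds_zero_nat (4 * Real.pi)).comp (tendsto_add_atTop_nat 1)
  -- (C) the defining sequences are Cauchy
  have hcauchy : ∀ (n : ℤ) (σ : Fin 2) (p : Fin 2 → ℝ), CauchySeq (a n σ p) := by
    intro n σ p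
    refine Metric.cauchySeq_iff'.2 fun ε hε => ?_
    have hlim : Tendsto (fun j : ℕ => ρ (j + 1) + D' * (0 + 4 * Real.pi / ((j + 1 : ℕ) : ℝ) +
        4 * Real.pi / ((j + 1 : ℕ) : ℝ))) atTop (𝓝 0) := by
      simpa using hρ1.add (((tendsto_const_nhds (x := (0 : ℝ))).add h4π |>.add h4π).const_mul D')
    obtain ⟨N₁, hN₁⟩ := eventually_atTop.1 (hlim.eventually (gt_mem_nhds hε))
    refine ⟨max N₁ L₀, fun j hj => ?_⟩
    rw [dist_comm, dist_eq_norm]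
    set N := max N₁ L₀ with hN
    have h := hest2 n σ p p N j (by omega) hj
    rw [klvc_tmod_self] at h
    have hmono : 4 * Real.pi / ((j + 1 : ℕ) : ℝ) ≤ 4 * Real.pi / ((N + 1 : ℕ) : ℝ) := by
      apply div_le_div_of_nonneg_left (by positivity) (by positivity)
      exact_mod_cast Nat.succ_le_succ hj
    calc ‖a n σ p N - a n σ p j‖
        ≤ ρ (N + 1) + D' * (0 + 4 * Real.pi / ((N + 1 : ℕ) : ℝ) + 4 * Real.pi / ((j + 1 : ℕ) : ℝ)) := h
      _ ≤ ρ (N + 1) + D' * (0 + 4 * Real.pi / ((N + 1 : ℕ) : ℝ) + 4 * Real.pi / ((N + 1 : ℕ) : ℝ)) := by gcongr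
      _ < ε := hN₁ N (le_max_left _ _)
  -- (L) the limits
  choose ell hell using fun (n : ℤ) (σ : Fin 2) (p : Fin 2 → ℝ) => cauchySeq_tendsto_of_complete (hcauchy n σ p)
  -- (Lip) the Lipschitz modulus of the limit
  have hlip : ∀ (n : ℤ) (σ : Fin 2) (p q : Fin 2 → ℝ),
      ‖ell n σ p - ell n σ q‖ ≤ D' * ∑ i, torusAbs (p i - q i) := by
    intro n σ p q
    have hT : Tendsto (fun j => ‖a n σ p j - a n σ q j‖) atTop (𝓝 ‖ell n σ p - ell n σ q‖) :=
      ((hell n σ p).sub (hell n σ q)).norm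
    have hR : Tendsto (fun j : ℕ => ρ (j + 1) + D' * (∑ i, torusAbs (p i - q i) +
        4 * Real.pi / ((j + 1 : ℕ) : ℝ) + 4 * Real.pi / ((j + 1 : ℕ) : ℝ))) atTop
        (𝓝 (D' * ∑ i, torusAbs (p i - q i))) := by
      have h := hρ1.add ((((tendsto_const_nhds (x := ∑ i, torusAbs (p i - q i))).add h4π).add h4π).const_mul D')
      simpa using h
    refine le_of_tendsto_of_tendsto hT hR ?_
    filter_upwards [eventually_ge_atTop L₀] with j hj
    exact hest2 n σ p q j j (by omega) le_rfl
  refine ⟨fun n p σ => ell n σ p, fun n σ p q => hlip n σ p q, fun n σ => ?_,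
    fun L _ hL M _ hM k σ => hbdd L hL M hM k σ, fun n σ ε hε => ?_⟩
  · -- continuity from the Lipschitz modulus
    have hK : LipschitzWith ⟨2 * D', by positivity⟩ (fun p : Fin 2 → ℝ => ell n σ p) := by
      refine LipschitzWith.of_dist_le_mul fun p q => ?_
      rw [dist_eq_norm, dist_eq_norm]
      calc ‖ell n σ p - ell n σ q‖ ≤ D' * ∑ i, torusAbs (p i - q i) := hlip n σ p q
        _ ≤ D' * (2 * ‖p - q‖) := mul_le_mul_of_nonneg_left (klvc_tmod_le_two_mul_norm p q) hD'0
        _ = ((⟨2 * D', by positivity⟩ : NNReal) : ℝ) * ‖p - q‖ := by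
            show D' * (2 * ‖p - q‖) = (2 * D') * ‖p - q‖
            ring
    exact hK.continuous
  · -- grid convergence: the grid value at `(L, M)` is within `ρ L` of the limit
    obtain ⟨N, hN⟩ := eventually_atTop.1 (hρ.eventually (eventually_le_nhds hε))
    refine ⟨max N L₀, fun L _ hL M _ hM ω hω k => ?_⟩
    have hL0 : L₀ ≤ L := le_of_max_le_right hL
    have hLN : N ≤ L := le_of_max_le_left hL
    have hT : Tendsto (fun j => ‖S L M (ω, k) σ - a n σ (latticeMomentum L k) j‖) atTop
        (𝓝 ‖S L M (ω, k) σ - ell n σ (latticeMomentum L k)‖) :=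
      (tendsto_const_nhds.sub (hell n σ (latticeMomentum L k))).norm
    have hR : Tendsto (fun j : ℕ => ρ L + D' * (0 + 4 * Real.pi / ((j + 1 : ℕ) : ℝ))) atTop (𝓝 (ρ L)) := by
      have h := (tendsto_const_nhds (x := ρ L)).add (((tendsto_const_nhds (x := (0 : ℝ))).add h4π).const_mul D')
      simpa using h
    have hle : ‖S L M (ω, k) σ - ell n σ (latticeMomentum L k)‖ ≤ ρ L := by
      refine le_of_tendsto_of_tendsto hT hR ?_
      filter_upwards [eventually_ge_atTop L] with j hj
      have h := hest n σ (latticeMomentum L k) L hL0 M hM ω hω k j (by omega)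
      rwa [klvc_tmod_self] at h
    exact hle.trans (hN L hLN)

/-- **Two-volume rate ⇒ the volume-limit clauses** (abstract form, the three clauses in the exact shape of
`volLimit_of_termwise`'s conclusion with `Mstar = Mth`): uniform bound beyond `(L₀, Mth)` + two-volume rate with cross-grid modulus
⇒ a momentum-continuous `Σ∞`, the bound, and grid convergence eventually in `L` and then in `M`. [folklore] -/
theorem volLimit_of_twoVolumeRate
    {S : ∀ (L M : ℕ) [NeZero L] [NeZero M], FreqMomentum L M → Fin 2 → ℂ} {Mth : ℕ → ℕ} {L₀ : ℕ}
    {B D : ℝ} {ρ : ℕ → ℝ} (hρ : Tendsto ρ atTop (𝓝 0))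
    (hbdd : ∀ (L : ℕ) [NeZero L], L₀ ≤ L → ∀ (M : ℕ) [NeZero M], Mth L ≤ M →
      ∀ (k : FreqMomentum L M) (σ : Fin 2), ‖S L M k σ‖ ≤ B)
    (hrate : ∀ (L : ℕ) [NeZero L], L₀ ≤ L → ∀ (M : ℕ) [NeZero M], Mth L ≤ M →
      ∀ (L' : ℕ) [NeZero L'], L ≤ L' → ∀ (M' : ℕ) [NeZero M'], Mth L' ≤ M' →
        ∀ (σ : Fin 2) (ω : MatsubaraIdx M) (ω' : MatsubaraIdx M'), matsubaraInt M ω = matsubaraInt M' ω' →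
          ∀ (k : TorusSite 2 L) (k' : TorusSite 2 L'),
            ‖S L M (ω, k) σ - S L' M' (ω', k') σ‖ ≤
              ρ L + D * ∑ i, torusAbs (latticeMomentum L k i - latticeMomentum L' k' i)) :
    ∃ sigmaInf : ℤ → (Fin 2 → ℝ) → Fin 2 → ℂ, ∃ B' : ℝ, ∃ L₀' : ℕ,
      (∀ (n : ℤ) (σ : Fin 2), Continuous fun p : Fin 2 → ℝ => sigmaInf n p σ) ∧
      (∀ (L : ℕ) [NeZero L], L₀' ≤ L → ∀ (M : ℕ) [NeZero M], Mth L ≤ M →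
        ∀ (k : FreqMomentum L M) (σ : Fin 2), ‖S L M k σ‖ ≤ B') ∧
      (∀ (n : ℤ) (σ : Fin 2) (ε : ℝ), 0 < ε → ∃ L₁ : ℕ, ∀ (L : ℕ) [NeZero L], L₁ ≤ L →
        ∃ M₁ : ℕ, ∀ (M : ℕ) [NeZero M], M₁ ≤ M → ∀ ω : MatsubaraIdx M, matsubaraInt M ω = n →
          ∀ k : TorusSite 2 L, ‖S L M (ω, k) σ - sigmaInf n (latticeMomentum L k) σ‖ ≤ ε) := by
  obtain ⟨sigmaInf, -, hcont, hB, hlim⟩ := volLimit_of_twoVolumeRate' hρ hbdd hrate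
  refine ⟨sigmaInf, B, L₀, hcont, hB, fun n σ ε hε => ?_⟩
  obtain ⟨L₁, hL₁⟩ := hlim n σ ε hε
  exact ⟨L₁, fun L _ hL => ⟨Mth L, fun M _ hM ω hω k => hL₁ L hL M hM ω hω k⟩⟩

/-! ## §4 The instance: the two-leg vertex function of the fully integrated countertermed action -/

/-- **Two-volume rate with cross-grid modulus ⇒ the volume-limit slot.**  If, beyond thresholds `(L₀, Mth)`, the two-leg vertex
function of the fully integrated countertermed action, `Σ̂_{L,M} = klSelfEnergy L M β U μ K klE0 (nScales β + 1)`, obeys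
(a) `‖Σ̂_{L,M}(k, σ)‖ ≤ B`, and (b) for `L₀ ≤ L ≤ L′`, `Mth L ≤ M`, `Mth L′ ≤ M′`, equal Matsubara integers and all torus momenta
`‖Σ̂_{L,M}((ω,k),σ) − Σ̂_{L′,M′}((ω′,k′),σ)‖ ≤ ρ L + D · Σ_i |p_k i − p′_{k′} i|_𝕋` with `ρ → 0`, then
`FinalTwoLegVolLimit β U μ K Mth` holds (`Σ∞` = the limit along floor grid points, `max D 0`-Lipschitz in the torus modulus). [folklore] -/
theorem finalTwoLegVolLimit_of_twoVolumeRate {β U μ : ℝ} {K : TrigPolyC4v} {Mth : ℕ → ℕ} {L₀ : ℕ} {B D : ℝ} {ρ : ℕ → ℝ}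
    (hρ : Tendsto ρ atTop (𝓝 0))
    (hbdd : ∀ (L : ℕ) [NeZero L], L₀ ≤ L → ∀ (M : ℕ) [NeZero M], Mth L ≤ M →
      ∀ (k : FreqMomentum L M) (σ : Fin 2), ‖klSelfEnergy L M β U μ K klE0 (nScales β + 1) k σ‖ ≤ B)
    (hrate : ∀ (L : ℕ) [NeZero L], L₀ ≤ L → ∀ (M : ℕ) [NeZero M], Mth L ≤ M →
      ∀ (L' : ℕ) [NeZero L'], L ≤ L' → ∀ (M' : ℕ) [NeZero M'], Mth L' ≤ M' →
        ∀ (σ : Fin 2) (ω : MatsubaraIdx M) (ω' : MatsubaraIdx M'), matsubaraInt M ω = matsubaraInt M' ω' →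
          ∀ (k : TorusSite 2 L) (k' : TorusSite 2 L'),
            ‖klSelfEnergy L M β U μ K klE0 (nScales β + 1) (ω, k) σ -
                klSelfEnergy L' M' β U μ K klE0 (nScales β + 1) (ω', k') σ‖ ≤
              ρ L + D * ∑ i, torusAbs (latticeMomentum L k i - latticeMomentum L' k' i)) :
    FinalTwoLegVolLimit β U μ K Mth :=
  volLimit_of_twoVolumeRate (S := fun L M _ _ k σ => klSelfEnergy L M β U μ K klE0 (nScales β + 1) k σ) hρ hbdd hrate

/-- The `∃ M'` form of `finalTwoLegVolLimit_of_twoVolumeRate` (the binding `VL := fun β U μ K _ => ∃ M', FinalTwoLegVolLimit β U μ K M'`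
suggested for the slot: the prover's own Matsubara threshold). [folklore] -/
theorem exists_finalTwoLegVolLimit_of_twoVolumeRate {β U μ : ℝ} {K : TrigPolyC4v} {Mth : ℕ → ℕ} {L₀ : ℕ} {B D : ℝ}
    {ρ : ℕ → ℝ} (hρ : Tendsto ρ atTop (𝓝 0))
    (hbdd : ∀ (L : ℕ) [NeZero L], L₀ ≤ L → ∀ (M : ℕ) [NeZero M], Mth L ≤ M →
      ∀ (k : FreqMomentum L M) (σ : Fin 2), ‖klSelfEnergy L M β U μ K klE0 (nScales β + 1) k σ‖ ≤ B)
    (hrate : ∀ (L : ℕ) [NeZero L], L₀ ≤ L → ∀ (M : ℕ) [NeZero M], Mth L ≤ M →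
      ∀ (L' : ℕ) [NeZero L'], L ≤ L' → ∀ (M' : ℕ) [NeZero M'], Mth L' ≤ M' →
        ∀ (σ : Fin 2) (ω : MatsubaraIdx M) (ω' : MatsubaraIdx M'), matsubaraInt M ω = matsubaraInt M' ω' →
          ∀ (k : TorusSite 2 L) (k' : TorusSite 2 L'),
            ‖klSelfEnergy L M β U μ K klE0 (nScales β + 1) (ω, k) σ -
                klSelfEnergy L' M' β U μ K klE0 (nScales β + 1) (ω', k') σ‖ ≤
              ρ L + D * ∑ i, torusAbs (latticeMomentum L k i - latticeMomentum L' k' i)) :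
    ∃ M' : ℕ → ℕ, FinalTwoLegVolLimit β U μ K M' :=
  ⟨Mth, finalTwoLegVolLimit_of_twoVolumeRate hρ hbdd hrate⟩

end Summit.HubbardSuperconductivity.HubbardSuperconductivity.Theorems.KLRegimeSplit
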